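import Summits.CriticalPhenomena.PercolationContinuityZ3.Theorems.PercNearOneGluingNoHeavyConstsMDLXJoint
import Summits.CriticalPhenomena.PercolationContinuityZ3.Theorems.PercNearOneGluingNoHeavyLowerTailCSHDefs
import Literature.Probability.LatticeModels.ProdBernoulliWeightContinuity
import HarnessLib

/-!
# Conjecture CSH′ (all levels): the conditioned slack hierarchy with the observer constant conditioned ALSO on the
# owner's avoided event — the all-level form of `Consts.MDLXJoint`

builds on p205010 (kernel theorem, internal audit signed; external expert review pending)

PAPER-2 track "percolation constants", part (ii), seat `prim-consts-2` (sharpening).  Support file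
(`--supports stmt-CriticalPhenomena-4575`): one `Prop` definition (OPEN, `@[conjecture]`) and two theorems; no sorries; standard axioms.

Theorem 1 of the tree (`CSH.cshHolds`): for non-degenerate weights `w`, owner `x`, avoided set `Y`, decoys `D`, observers `o ≠ v`,
`0 ≤ CSH.cshMargin w x Y D o v f = cshMarg (decoyList w (insert x Y) D) p o v (covD w x Y f)` for every monotone `f`, where the
observer constant is `p = CSH.obsConst w o v A = P(o ↔ v | v ↮ A)`, `A = {x} ∪ Y ∪ D` — a probability under the UNCONDITIONED measure,
while `covD` is the (denominator-free) covariance under `P( · | x ↮ Y)`.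

* `Consts.CSHObsJoint` — **CONJECTURE CSH′**: the same margin is nonnegative with `p` replaced by the jointly-conditioned
  `p′ = P(o ↔ v | v ↮ A, x ↮ Y) = μ({v ↮ A} ∩ {x ↮ Y} ∩ {o ↔ v}) / μ({v ↮ A} ∩ {x ↮ Y})` (decoy constants unchanged).  Since `p ≤ p′`
  (`Consts.jointObserverConst_ge`, with `{x} ∪ Y ∪ D` in the role of the avoided set) and the `v`-slot of the level form is `≥ 0` in every
  census instance, CSH′ is a strengthening of Theorem 1; at `D = []` it is `Consts.MDLXJoint` (`Consts.mdlxJoint_of_cshObsJoint`, for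
  non-degenerate weights); at `Y = ∅` it IS Theorem 1 (`p′ = p`).  OPEN (conjectured in this programme, 2026-08-21).  EVIDENCE: ttrl2 lane
  `consts` EXHAUSTIVE census `n ≤ 6` (run/shared/lean/ttrl/consts/CONSTS.md §3b, 2026-08-21T01:21Z; requests.jsonl l.1195): all 8 532
  placements with `Y ≠ ∅` (`n = 4, 5, 6`; levels `k = 0, 1, 2`; palettes `½`, grid7, iid20), two independent exact engines: `p′` admissible in
  8 532 / 8 532, never tight (min `p_hi/p′ = 1.0087`); this seat's random/adversarial `n ≤ 6` search (levelk_direct.py / levelk_joint.py, two-sided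
  over ALL edge up-sets) 200 / 200.  The variant with the decoy constants ALSO conditioned on `x ↮ Y` (all constants under `P( · | x ↮ Y)`) is
  clean on this seat's 80 random placements and queued at ttrl2 (l.1255); it is not typed here.
* `Consts.cshObsJoint_margin_nil` — the `D = []` margin of CSH′ unfolded: `covD f o − p′ · covD f v`.
* `Consts.mdlxJoint_of_cshObsJoint` — CSH′ at `D = []` gives the inequality of `Consts.MDLXJoint` for non-degenerate weights (multiply by
  `μ({v ↮ {x}∪Y} ∩ {x ↮ Y}) > 0`).

References: J. van den Berg, O. Häggström, J. Kahn, Random Struct. Alg. 29 (2006) §2.1; G. Kozma, N. Nitzan, arXiv:2401.12397, Conj. 4 (p. 32).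
-/

noncomputable section

namespace Summit.CriticalPhenomena.PercolationContinuityZ3.Theorems

open MeasureTheory Set Literature.Probability.LatticeModels Literature.Probability.Percolation
open scoped Classical

namespace Consts

/-- **CONJECTURE CSH′ (all levels, observer form).**  For every `n`, non-degenerate weights `w` on `Fin n`, owner `x`, avoided finset `Y ∌ x`,
decoy list `D` (no duplicates, avoiding `x, Y, o, v`), observers `o ≠ v` outside `{x} ∪ Y`, and every monotone functional `f` of the open
edge cluster of `x`: the CSH margin built with the tree's decoy constants (`CSH.decoyList`) but with the observer constant
`p′ = μ({v ↮ A} ∩ {x ↮ Y} ∩ {o ↔ v}) / μ({v ↮ A} ∩ {x ↮ Y})`, `A = {x} ∪ Y ∪ D`, is nonnegative.  The tree's Theorem 1 (`CSH.cshAll`) is the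
same statement with `p = CSH.obsConst w o v A = μ({v ↮ A} ∩ {o ↔ v}) / μ{v ↮ A} ≤ p′`.  OPEN; exact census n ≤ 6: 8 532 / 8 532 placements
(ttrl2 consts CONSTS.md §3b), 0 violations.  builds on p205010 (kernel theorem, internal audit signed; external expert review pending).
[cite: VandenbergHaggstromKahn2005, §2.1 (pp. 9–13)] [status: open] -/
@[conjecture] def CSHObsJoint : Prop :=
  ∀ (n : ℕ) (w : Sym2 (Fin n) → unitInterval), (∀ e, 0 < w e ∧ w e < 1) →
    ∀ (x : Fin n) (Y : Finset (Fin n)) (D : List (Fin n)) (o v : Fin n),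
      x ∉ Y → o ∉ insert x (↑Y : Set (Fin n)) → v ∉ insert x (↑Y : Set (Fin n)) → o ≠ v → D.Nodup →
      (∀ d ∈ D, d ∉ insert x (↑Y : Set (Fin n)) ∧ d ≠ o ∧ d ≠ v) →
      ∀ f : Set (Sym2 (Fin n)) → ℝ, Monotone f →
        0 ≤ CSH.cshMarg (CSH.decoyList w (insert x (↑Y : Set (Fin n))) D)
          ((prodBernoulli w).real
              ({ω : BondConfig (Fin n) | ∀ a ∈ insert x (↑Y : Set (Fin n)) ∪ {d | d ∈ D}, ¬ (openGraph ω).Reachable v a} ∩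
                {ω | ∀ y ∈ (↑Y : Set (Fin n)), ¬ (openGraph ω).Reachable x y} ∩ openConn o v) /
            (prodBernoulli w).real
              ({ω : BondConfig (Fin n) | ∀ a ∈ insert x (↑Y : Set (Fin n)) ∪ {d | d ∈ D}, ¬ (openGraph ω).Reachable v a} ∩
                {ω | ∀ y ∈ (↑Y : Set (Fin n)), ¬ (openGraph ω).Reachable x y}))
          o v (CSH.covD w x (↑Y : Set (Fin n)) f)

/-- The `D = []` margin of CSH′ is `covD f o − p′ · covD f v`, with the avoided set `{x} ∪ Y`. [folklore] -/
theorem cshObsJoint_margin_nil {n : ℕ} (w : Sym2 (Fin n) → unitInterval) (x : Fin n) (Y : Finset (Fin n)) (o v : Fin n)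
    (p' : ℝ) (f : Set (Sym2 (Fin n)) → ℝ) :
    CSH.cshMarg (CSH.decoyList w (insert x (↑Y : Set (Fin n))) []) p' o v (CSH.covD w x (↑Y : Set (Fin n)) f) =
      CSH.covD w x (↑Y : Set (Fin n)) f o - p' * CSH.covD w x (↑Y : Set (Fin n)) f v := by
  simp only [CSH.decoyList, CSH.cshMarg_nil]

/-- **CSH′ at `D = []` is MDL(X)′ (`Consts.MDLXJoint`), for non-degenerate weights**: multiplying the level-0 margin of CSH′ by
`μ({v ↮ {x}∪Y} ∩ {x ↮ Y}) > 0` gives `μ(𝒜 ∩ D ∩ W)·cov_D(f; x ↔ v) ≤ μ(𝒜 ∩ D)·cov_D(f; x ↔ o)`.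
[cite: VandenbergHaggstromKahn2005, §2.1 (pp. 9–13)] -/
theorem mdlxJoint_of_cshObsJoint (h : CSHObsJoint) {n : ℕ} (w : Sym2 (Fin n) → unitInterval) (hw : ∀ e, 0 < w e ∧ w e < 1)
    (x : Fin n) (Y : Finset (Fin n)) (o v : Fin n) (hxY : x ∉ Y) (ho : o ∉ insert x (↑Y : Set (Fin n)))
    (hv : v ∉ insert x (↑Y : Set (Fin n))) (hov : o ≠ v) (f : Set (Sym2 (Fin n)) → ℝ) (hf : Monotone f) :
    (prodBernoulli w).real ({ω : BondConfig (Fin n) | ∀ a ∈ insert x (↑Y : Set (Fin n)), ¬ (openGraph ω).Reachable v a} ∩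
          {ω | ∀ y ∈ (↑Y : Set (Fin n)), ¬ (openGraph ω).Reachable x y} ∩ openConn v o) *
        CSH.covD w x (↑Y : Set (Fin n)) f v ≤
      (prodBernoulli w).real ({ω : BondConfig (Fin n) | ∀ a ∈ insert x (↑Y : Set (Fin n)), ¬ (openGraph ω).Reachable v a} ∩
          {ω | ∀ y ∈ (↑Y : Set (Fin n)), ¬ (openGraph ω).Reachable x y}) *
        CSH.covD w x (↑Y : Set (Fin n)) f o := by
  have key := h n w hw x Y [] o v hxY ho hv hov List.nodup_nil (fun d hd => absurd hd List.not_mem_nil) f hf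
  rw [cshObsJoint_margin_nil] at key
  have hset : insert x (↑Y : Set (Fin n)) ∪ {d : Fin n | d ∈ ([] : List (Fin n))} = insert x (↑Y : Set (Fin n)) := by
    ext u; simp
  rw [hset, KNPreFKG.openConn_symm o v] at key
  set M := (prodBernoulli w).real ({ω : BondConfig (Fin n) | ∀ a ∈ insert x (↑Y : Set (Fin n)), ¬ (openGraph ω).Reachable v a} ∩
      {ω | ∀ y ∈ (↑Y : Set (Fin n)), ¬ (openGraph ω).Reachable x y}) with hM
  set E := (prodBernoulli w).real ({ω : BondConfig (Fin n) | ∀ a ∈ insert x (↑Y : Set (Fin n)), ¬ (openGraph ω).Reachable v a} ∩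
      {ω | ∀ y ∈ (↑Y : Set (Fin n)), ¬ (openGraph ω).Reachable x y} ∩ openConn v o) with hE
  -- the conditioning event contains the empty configuration, hence has positive probability
  have hMpos : 0 < M := by
    refine prodBernoulli_real_pos_of_nonempty hw ⟨∅, ?_, ?_⟩
    · intro a ha hreach
      have hbot : openGraph (∅ : BondConfig (Fin n)) = ⊥ := by
        unfold openGraph; exact SimpleGraph.fromEdgeSet_empty
      rw [hbot, SimpleGraph.reachable_bot] at hreach
      exact hv (hreach ▸ ha)
    · intro y hy hreach
      have hbot : openGraph (∅ : BondConfig (Fin n)) = ⊥ := by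
        unfold openGraph; exact SimpleGraph.fromEdgeSet_empty
      rw [hbot, SimpleGraph.reachable_bot] at hreach
      exact hxY (by rw [hreach]; exact_mod_cast hy)
  have h1 : M * (CSH.covD w x (↑Y : Set (Fin n)) f o - E / M * CSH.covD w x (↑Y : Set (Fin n)) f v) =
      M * CSH.covD w x (↑Y : Set (Fin n)) f o - E * CSH.covD w x (↑Y : Set (Fin n)) f v := by
    field_simp
  have h2 : 0 ≤ M * (CSH.covD w x (↑Y : Set (Fin n)) f o - E / M * CSH.covD w x (↑Y : Set (Fin n)) f v) :=
    mul_nonneg hMpos.le key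
  rw [h1] at h2
  linarith

end Consts

end Summit.CriticalPhenomena.PercolationContinuityZ3.Theorems

end
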